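import Summits.Ventures.Crystal3D.Theorems.StickyWulffConstantStackingLiminfSkewBound
import HarnessLib

/-!
# The SKEW BOUND `∫ |V⁻ − f̄ v| ≤ C (K·D + N/K)` (step S4 of stub (B) `stub_mollifiedUpper`, line
# `LayerChain` v4, crux `StackingLiminf`, stmt-Ventures-19145) — the hypothesis `hE` of wulff-p2's
# `mollifiedUpper_of_skewBound`

Route `StickyWulffConstant` of the venture `Summits/Ventures/Crystal3D` (cell `crystal3d-full`).
**`skewBound`**: there is `C ≥ 0` (here `4·10⁵·bumpConst`) such that for every Hägg word `σ`, injective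
`x ⊂ barlowStacking 1 √(2/3) σ` with layer map `kf`, and `1 ≤ K ≤ L`:
`∫ |Σ_{i : σ (kf i) ≠ 1} φ_K(y − x_i) − window σ K (y₂) · Σ_i φ_K(y − x_i)| dy ≤ C·(K·(6N − numContacts x) + N/K)`.
This is LITERALLY the hypothesis of `mollifiedUpper_of_skewBound` (`…MollifiedUpperOfSkew`, wulff-p2 g4), so
`stub_mollifiedUpper := mollifiedUpper_of_skewBound skewBound` closes stub (B).
Proof: pointwise (`abs_skew_pointwise`) `|E| ≤ v` and, for `K ≥ 192√2·bumpConst`, `|E| ≤ 4 v·u_big + 32Kδ_K·v`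
(`abs_le_four_mul_of_halves`; `u_big` the vacant sum over a fixed index box); integrate with
`integral_dens_mul_vacant_le` (`∫ v·u_big ≤ 84200·bumpConst·K·D`) and `∫ v = N/√2`; for small `K`,
`∫|E| ≤ ∫ v = N/√2 ≤ 192·bumpConst·N/K`.
WHAT THIS IS NOT: not the closing file of (B) (one line, left to the stub owner / next file); rung F-C1 not moved.
-/

noncomputable section

namespace Summit.Ventures.Crystal3D.Theorems.PlateauHeight

open MeasureTheory Finset
open Literature.MathematicalPhysics.StatisticalMechanics
open Summit.Ventures.Crystal3D.Cruxes.StackingLiminf.LayerChainV4 (bump bumpConst dens layerProf window)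
open Summit.Ventures.Crystal3D.LayerChain (dot3)

/-- The mollified density has compact support. -/
theorem hasCompactSupport_dens {N : ℕ} (x : Fin N → EuclideanSpace ℝ (Fin 3)) {K : ℝ} (hK : 0 < K) :
    HasCompactSupport (dens x K) := by
  set R : ℝ := K + ∑ i : Fin N, ∑ l : Fin 3, |x i l| with hR
  refine HasCompactSupport.intro (isCompact_closedBall (0 : Fin 3 → ℝ) R) fun y hy => ?_
  rw [Metric.mem_closedBall, dist_zero_right, not_le] at hy
  obtain ⟨j, hj⟩ : ∃ j : Fin 3, R < |y j| := by
    by_contra h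
    push Not at h
    have : ‖y‖ ≤ R := (pi_norm_le_iff_of_nonneg (by rw [hR]; positivity)).2 fun j => by
      rw [Real.norm_eq_abs]; exact h j
    linarith
  exact dens_eq_zero_of_coord x hK y j (by rw [hR] at hj; exact hj.le)

set_option maxHeartbeats 1600000 in
/-- **The skew bound** (hypothesis `hE` of `mollifiedUpper_of_skewBound`). -/
theorem skewBound : ∃ C : ℝ, 0 ≤ C ∧ ∀ (N : ℕ) (σ : ℤ → ℤ), IsHaggSeq σ →
    ∀ x : Fin N → EuclideanSpace ℝ (Fin 3), Function.Injective x →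
      (∀ i, x i ∈ barlowStacking 1 (Real.sqrt (2 / 3)) σ) →
      ∀ kf : Fin N → ℤ, (∀ i, x i 2 = kf i * Real.sqrt (2 / 3)) →
      ∀ K L : ℝ, 1 ≤ K → K ≤ L →
        ∫ y : Fin 3 → ℝ, |(∑ i ∈ Finset.univ.filter (fun i => σ (kf i) ≠ 1),
            bump K (y - WithLp.ofLp (x i))) -
            window σ K (y 2) * ∑ i, bump K (y - WithLp.ofLp (x i))| ≤
          C * (K * (6 * (N : ℝ) - (Summit.Ventures.Crystal3D.numContacts x : ℝ)) + (N : ℝ) / K) := by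
  classical
  refine ⟨400000 * bumpConst, by have := bumpConst_pos; positivity, ?_⟩
  intro N σ hσ x hx hmem kf hkf K L hK hKL
  have hb : 0 < bumpConst := bumpConst_pos
  have hK0 : 0 < K := by linarith
  have hr2 : 0 < Real.sqrt 2 := Real.sqrt_pos.2 (by norm_num)
  have hr2' : (4 : ℝ) / 3 < Real.sqrt 2 := by
    rw [show (4 : ℝ) / 3 = Real.sqrt ((4 / 3) ^ 2) by rw [Real.sqrt_sq (by norm_num)]]
    exact Real.sqrt_lt_sqrt (by norm_num) (by norm_num)
  have hr3 : (17 : ℝ) / 10 < Real.sqrt 3 := seventeen_tenths_lt_sqrt_three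
  have hh0 : 0 < Real.sqrt (2 / 3) := Real.sqrt_pos.2 (by norm_num)
  have hh45 : (4 : ℝ) / 5 < Real.sqrt (2 / 3) := four_fifths_lt_sqrt_two_thirds
  -- indices
  have hmem' := hmem
  choose kk aa bb hkab using hmem'
  set idx : Fin N → ℤ × ℤ × ℤ := fun i => (kk i, aa i, bb i) with hidx_def
  have hidx : ∀ i, x i = barlowPos 1 (Real.sqrt (2 / 3)) σ (idx i).1 (idx i).2.1 (idx i).2.2 :=
    fun i => hkab i
  have hkf' : ∀ i, kf i = (idx i).1 := by
    intro i
    have h1 := hkf i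
    rw [hidx i, barlowPos_apply_two] at h1
    exact_mod_cast (mul_right_cancel₀ hh0.ne' h1).symm
  have hfilt : Finset.univ.filter (fun i => σ (kf i) ≠ 1) = Finset.univ.filter (fun i => σ (idx i).1 ≠ 1) := by
    ext i; simp [hkf' i]
  simp only [hfilt]
  -- deficiency
  set D : ℝ := 6 * (N : ℝ) - (Summit.Ventures.Crystal3D.numContacts x : ℝ) with hD
  have h2C : 2 * Summit.Ventures.Crystal3D.numContacts x ≤ 12 * N := by
    have h := card_grid_boundary_add_le hσ x hx hmem idx hidx (1, 0, 0) (by simp)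
    omega
  have hD0 : 0 ≤ D := by
    have : (2 * Summit.Ventures.Crystal3D.numContacts x : ℝ) ≤ 12 * (N : ℝ) := by exact_mod_cast h2C
    rw [hD]; linarith
  have hMcast : ((12 * N - 2 * Summit.Ventures.Crystal3D.numContacts x : ℕ) : ℝ) = 2 * D := by
    rw [Nat.cast_sub h2C]; push_cast; rw [hD]; ring
  -- the working box
  set R : ℝ := ∑ i : Fin N, ∑ l : Fin 3, |x i l| with hR
  have hR0 : 0 ≤ R := by rw [hR]; positivity
  have hRx : ∀ i l, |x i l| ≤ R := fun i l =>
    le_trans (Finset.single_le_sum (f := fun l' => |x i l'|) (fun _ _ => abs_nonneg _) (Finset.mem_univ l))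
      (Finset.single_le_sum (f := fun i' => ∑ l' : Fin 3, |x i' l'|)
        (fun _ _ => Finset.sum_nonneg fun _ _ => abs_nonneg _) (Finset.mem_univ i))
  set K' : ℝ := R + 2 * K + 1 with hK'
  have hK'1 : 1 ≤ K' := by rw [hK']; linarith
  set Gbox : Finset (ℤ × ℤ) := Finset.Icc (-(⌈9 * K'⌉₊ : ℤ)) ⌈9 * K'⌉₊ ×ˢ
    Finset.Icc (-(⌈6 * K'⌉₊ : ℤ)) ⌈6 * K'⌉₊ with hGbox
  set Kbig : Finset ℤ := Finset.Icc (-(⌈3 * K'⌉₊ : ℤ)) ⌈3 * K'⌉₊ with hKbig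
  set Fbig : Finset (ℤ × ℤ × ℤ) := Kbig ×ˢ Gbox with hFbig
  -- coordinates of the origin site and the index-box lemma
  have hO0 : ∀ l : Fin 3, (barlowPos 1 (Real.sqrt (2 / 3)) σ 0 0 0) l = 0 := by
    intro l; fin_cases l <;> simp
  have hbox : ∀ k i j : ℤ, |(barlowPos 1 (Real.sqrt (2 / 3)) σ k i j) 2| < 2 * K' →
      |(barlowPos 1 (Real.sqrt (2 / 3)) σ k i j) 0| < 2 * K' + 2 * K' →
      |(barlowPos 1 (Real.sqrt (2 / 3)) σ k i j) 1| < 2 * K' + 2 * K' →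
      k ∈ Kbig ∧ (i, j) ∈ Gbox := by
    intro k i j h2 h0 h1
    have h := idx_sub_le_of_near hσ hK'1 le_rfl 0 0 0 k i j
      (by rw [hO0, sub_zero]; exact h2) (by rw [hO0, sub_zero]; exact h0) (by rw [hO0, sub_zero]; exact h1)
    simp only [Int.cast_zero, sub_zero] at h
    obtain ⟨dk, di, dj⟩ := h
    refine ⟨mem_Icc_of_abs_le dk, ?_⟩
    rw [hGbox, Finset.mem_product]
    exact ⟨mem_Icc_of_abs_le di, mem_Icc_of_abs_le dj⟩
  -- occupied lateral indices are in the box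
  have hGocc : ∀ i, (idx i).2 ∈ Gbox := by
    intro i
    have h := hbox (idx i).1 (idx i).2.1 (idx i).2.2
    rw [← hidx i] at h
    refine (h ?_ ?_ ?_).2
    · linarith [hRx i 2]
    · linarith [hRx i 0]
    · linarith [hRx i 1]
  -- the vacant sum over the big box
  set ubig : (Fin 3 → ℝ) → ℝ := fun y => ∑ t ∈ Fbig.filter (fun t => t ∉ Finset.univ.image idx),
    bump K (fun l => y l - (barlowPos 1 (Real.sqrt (2 / 3)) σ t.1 t.2.1 t.2.2) l) with hubig
  have hubig0 : ∀ y, 0 ≤ ubig y := fun y => Finset.sum_nonneg fun t _ => bump_nonneg hK0 _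
  set δ : ℝ := 2 / Real.sqrt 3 * (12 * bumpConst / K ^ 4 * ((2 * (K + 2)) * (2 * (K + 2)))) with hδ
  have hδ0 : 0 ≤ δ := by rw [hδ]; positivity
  have hv0 : ∀ y, 0 ≤ dens x K y := fun y => dens_nonneg x hK0 y
  -- POINTWISE
  have hpt : ∀ y : Fin 3 → ℝ,
      |(∑ i ∈ Finset.univ.filter (fun i => σ (idx i).1 ≠ 1), bump K (y - WithLp.ofLp (x i))) -
          window σ K (y 2) * ∑ i, bump K (y - WithLp.ofLp (x i))| ≤ dens x K y ∧
      (192 * Real.sqrt 2 * bumpConst ≤ K →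
        |(∑ i ∈ Finset.univ.filter (fun i => σ (idx i).1 ≠ 1), bump K (y - WithLp.ofLp (x i))) -
          window σ K (y 2) * ∑ i, bump K (y - WithLp.ofLp (x i))| ≤
        4 * dens x K y * ubig y + 4 * dens x K y * (8 * K * δ)) := by
    intro y
    have hv_eq : (∑ i, bump K (y - WithLp.ofLp (x i))) = dens x K y := by
      unfold Summit.Ventures.Crystal3D.Cruxes.StackingLiminf.LayerChainV4.dens; rfl
    by_cases hv : dens x K y = 0
    · -- all bumps vanish at `y`
      have hall : ∀ i, bump K (y - WithLp.ofLp (x i)) = 0 := by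
        have h := (Finset.sum_eq_zero_iff_of_nonneg (fun i _ => bump_nonneg hK0 (y - WithLp.ofLp (x i)))).1
          (hv_eq.trans hv)
        exact fun i => h i (Finset.mem_univ i)
      have hE0 : (∑ i ∈ Finset.univ.filter (fun i => σ (idx i).1 ≠ 1), bump K (y - WithLp.ofLp (x i))) -
          window σ K (y 2) * ∑ i, bump K (y - WithLp.ofLp (x i)) = 0 := by
        rw [Finset.sum_eq_zero (fun i _ => hall i), Finset.sum_eq_zero (fun i _ => hall i)]; ring
      rw [hE0, abs_zero, hv]
      exact ⟨le_rfl, fun _ => by simp⟩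
    · -- some ball is `K`-close to `y` in every coordinate
      obtain ⟨i₀, hi₀⟩ : ∃ i₀, bump K (y - WithLp.ofLp (x i₀)) ≠ 0 := by
        by_contra h
        push Not at h
        exact hv (by rw [← hv_eq]; exact Finset.sum_eq_zero fun i _ => h i)
      have hyc : ∀ l : Fin 3, |y l| < R + K := by
        intro l
        have hl : |y l - x i₀ l| < K := by
          by_contra hge
          rw [not_lt] at hge
          exact hi₀ (bump_eq_zero_of_coord hK0 l (by simpa using hge))
        have := hRx i₀ l
        have t := abs_sub_abs_le_abs_sub (y l) (x i₀ l)
        linarith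
      have hGnear : ∀ k i j : ℤ, |y 2 - k * Real.sqrt (2 / 3)| < K →
          Real.sqrt ((y 0 - ((i : ℝ) + j / 2 + haggLabel σ k / 2)) ^ 2 +
            (y 1 - (Real.sqrt 3 / 2 * j + Real.sqrt 3 * haggLabel σ k / 6)) ^ 2) < K →
          (i, j) ∈ Gbox := by
        intro k i j hk hl
        have hP2 : (barlowPos 1 (Real.sqrt (2 / 3)) σ k i j) 2 = k * Real.sqrt (2 / 3) := by simp
        have hP0 : (barlowPos 1 (Real.sqrt (2 / 3)) σ k i j) 0 = (i : ℝ) + j / 2 + haggLabel σ k / 2 := by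
          simp
        have hP1 : (barlowPos 1 (Real.sqrt (2 / 3)) σ k i j) 1 =
            Real.sqrt 3 / 2 * j + Real.sqrt 3 * haggLabel σ k / 6 := by
          simp; ring
        have hl0 : |y 0 - ((i : ℝ) + j / 2 + haggLabel σ k / 2)| < K := by
          calc |y 0 - ((i : ℝ) + j / 2 + haggLabel σ k / 2)|
              = Real.sqrt ((y 0 - ((i : ℝ) + j / 2 + haggLabel σ k / 2)) ^ 2) := (Real.sqrt_sq_eq_abs _).symm
            _ ≤ _ := Real.sqrt_le_sqrt (by nlinarith)
            _ < K := hl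
        have hl1 : |y 1 - (Real.sqrt 3 / 2 * j + Real.sqrt 3 * haggLabel σ k / 6)| < K := by
          calc |y 1 - (Real.sqrt 3 / 2 * j + Real.sqrt 3 * haggLabel σ k / 6)|
              = Real.sqrt ((y 1 - (Real.sqrt 3 / 2 * j + Real.sqrt 3 * haggLabel σ k / 6)) ^ 2) :=
                (Real.sqrt_sq_eq_abs _).symm
            _ ≤ _ := Real.sqrt_le_sqrt (by nlinarith)
            _ < K := hl
        refine (hbox k i j ?_ ?_ ?_).2
        · rw [hP2]
          have t := abs_sub_abs_le_abs_sub (k * Real.sqrt (2 / 3)) (y 2)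
          rw [abs_sub_comm] at hk
          linarith [hyc 2]
        · rw [hP0]
          have t := abs_sub_abs_le_abs_sub ((i : ℝ) + j / 2 + haggLabel σ k / 2) (y 0)
          rw [abs_sub_comm] at hl0
          linarith [hyc 0]
        · rw [hP1]
          have t := abs_sub_abs_le_abs_sub (Real.sqrt 3 / 2 * j + Real.sqrt 3 * haggLabel σ k / 6) (y 1)
          rw [abs_sub_comm] at hl1
          linarith [hyc 1]
      have hsk := abs_skew_pointwise hσ x hx idx hidx hK y Gbox hGocc hGnear
      simp only at hsk
      obtain ⟨h1, h2, h3⟩ := hsk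
      refine ⟨h1, fun hKbig => ?_⟩
      -- the vacant sum over `Kset(y) ×ˢ Gbox` is dominated by `ubig`
      have hsub : ((finite_layers (y 2) K).toFinset ×ˢ Gbox).filter (fun t => t ∉ Finset.univ.image idx) ⊆
          Fbig.filter (fun t => t ∉ Finset.univ.image idx) := by
        intro t ht
        rw [Finset.mem_filter, Finset.mem_product] at ht ⊢
        refine ⟨⟨?_, ht.1.2⟩, ht.2⟩
        have hk : |y 2 - t.1 * Real.sqrt (2 / 3)| < K := by
          have := ht.1.1
          rw [Set.Finite.mem_toFinset] at this
          exact this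
        -- `|t.1| h < R + 2K < (4/5)·3K'`
        refine mem_Icc_of_abs_le ?_
        have t2 := abs_sub_abs_le_abs_sub (t.1 * Real.sqrt (2 / 3)) (y 2)
        rw [abs_sub_comm] at hk
        rw [abs_mul, abs_of_pos hh0] at t2
        have hy2 := hyc 2
        have ht1 : |(t.1 : ℝ)| * Real.sqrt (2 / 3) < R + 2 * K := by linarith only [t2, hk, hy2]
        have ht2 : |(t.1 : ℝ)| * (4 / 5) ≤ |(t.1 : ℝ)| * Real.sqrt (2 / 3) :=
          mul_le_mul_of_nonneg_left hh45.le (abs_nonneg _)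
        have hK'e : K' = R + 2 * K + 1 := rfl
        linarith only [ht1, ht2, hK'e, hR0, hK0]
      have hu_le : (∑ t ∈ ((finite_layers (y 2) K).toFinset ×ˢ Gbox).filter
            (fun t => t ∉ Finset.univ.image idx),
          bump K (fun l => y l - (barlowPos 1 (Real.sqrt (2 / 3)) σ t.1 t.2.1 t.2.2) l)) ≤ ubig y :=
        Finset.sum_le_sum_of_subset_of_nonneg hsub fun t _ _ => bump_nonneg hK0 _
      have hhalf : 1 / 2 ≤ dens x K y + ubig y := by
        have hc : 96 * Real.sqrt 2 * bumpConst / K ≤ 1 / 2 := by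
          rw [div_le_iff₀ hK0]; linarith only [hKbig]
        linarith only [hc, h3, hu_le]
      have hE2 : |(∑ i ∈ Finset.univ.filter (fun i => σ (idx i).1 ≠ 1), bump K (y - WithLp.ofLp (x i))) -
          window σ K (y 2) * ∑ i, bump K (y - WithLp.ofLp (x i))| ≤ ubig y + 8 * K * δ := by
        linarith only [h2, hu_le]
      exact abs_le_four_mul_of_halves (hv0 y) (hubig0 y) (by positivity) h1 hE2 hhalf
  -- INTEGRATE
  have hint_v : ∫ y, dens x K y = (N : ℝ) / Real.sqrt 2 := integral_dens x hK0
  have hvint : Integrable (dens x K) :=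
    (contDiff_dens x K).continuous.integrable_of_hasCompactSupport (hasCompactSupport_dens x hK0)
  have hnonneg : 0 ≤ᵐ[volume] fun y : Fin 3 → ℝ =>
      |(∑ i ∈ Finset.univ.filter (fun i => σ (idx i).1 ≠ 1), bump K (y - WithLp.ofLp (x i))) -
          window σ K (y 2) * ∑ i, bump K (y - WithLp.ofLp (x i))| :=
    ae_of_all _ fun y => abs_nonneg _
  by_cases hKbig : 192 * Real.sqrt 2 * bumpConst ≤ K
  · -- large `K`
    have hucont : Continuous ubig := by
      rw [hubig]
      refine continuous_finsetSum _ fun t _ => (continuous_bump K).comp ?_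
      exact continuous_pi fun l => (continuous_apply l).sub continuous_const
    have hg_int : Integrable fun y => 4 * dens x K y * ubig y + 4 * dens x K y * (8 * K * δ) := by
      have hc : Continuous fun y => 4 * dens x K y * ubig y + 4 * dens x K y * (8 * K * δ) := by
        have hd := (contDiff_dens x K).continuous
        fun_prop
      refine hc.integrable_of_hasCompactSupport ?_
      refine (hasCompactSupport_dens x hK0).mono ?_
      intro y hy
      rw [Function.mem_support] at hy ⊢
      intro h0
      apply hy
      rw [h0]; ring
    have hstep : ∫ y : Fin 3 → ℝ, |(∑ i ∈ Finset.univ.filter (fun i => σ (idx i).1 ≠ 1),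
        bump K (y - WithLp.ofLp (x i))) - window σ K (y 2) * ∑ i, bump K (y - WithLp.ofLp (x i))| ≤
        ∫ y, (4 * dens x K y * ubig y + 4 * dens x K y * (8 * K * δ)) :=
      integral_mono_of_nonneg hnonneg hg_int (ae_of_all _ fun y => (hpt y).2 hKbig)
    refine hstep.trans ?_
    have hsplit : ∫ y, (4 * dens x K y * ubig y + 4 * dens x K y * (8 * K * δ)) =
        4 * (∫ y, dens x K y * ubig y) + 4 * (8 * K * δ) * ∫ y, dens x K y := by
      have hi2 : Integrable fun y => 4 * dens x K y * (8 * K * δ) := by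
        have e : (fun y => 4 * dens x K y * (8 * K * δ)) = fun y => (4 * (8 * K * δ)) * dens x K y := by
          funext y; ring
        rw [e]; exact hvint.const_mul _
      have hi1 : Integrable fun y => 4 * dens x K y * ubig y := by
        have := hg_int.sub hi2
        refine this.congr (ae_of_all _ fun y => ?_)
        show 4 * dens x K y * ubig y + 4 * dens x K y * (8 * K * δ) - 4 * dens x K y * (8 * K * δ) =
          4 * dens x K y * ubig y
        ring
      rw [integral_add hi1 hi2]
      have e1 : (fun y => 4 * dens x K y * ubig y) = fun y => 4 * (dens x K y * ubig y) := by
        funext y; ring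
      have e2 : (fun y => 4 * dens x K y * (8 * K * δ)) = fun y => (4 * (8 * K * δ)) * dens x K y := by
        funext y; ring
      rw [e1, e2, integral_const_mul, integral_const_mul]
    rw [hsplit, hint_v]
    -- the overlap integral
    have hov := integral_dens_mul_vacant_le hσ x hx hmem idx hidx Fbig hK
    rw [Nat.cast_mul, hMcast] at hov
    have hQ : (((2 * ⌈3 * K⌉₊ + 1) * (2 * ⌈9 * K⌉₊ + 1) * (2 * ⌈6 * K⌉₊ + 1) *
        (⌈3 * K⌉₊ + ⌈9 * K⌉₊ + ⌈6 * K⌉₊) : ℕ) : ℝ) ≤ 59535 * K ^ 4 := by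
      have hn₃ : (⌈3 * K⌉₊ : ℝ) ≤ 4 * K := by
        have := Nat.ceil_lt_add_one (show 0 ≤ 3 * K by positivity); linarith
      have hn₁ : (⌈9 * K⌉₊ : ℝ) ≤ 10 * K := by
        have := Nat.ceil_lt_add_one (show 0 ≤ 9 * K by positivity); linarith
      have hn₂ : (⌈6 * K⌉₊ : ℝ) ≤ 7 * K := by
        have := Nat.ceil_lt_add_one (show 0 ≤ 6 * K by positivity); linarith
      push_cast
      have h1 : (2 * (⌈3 * K⌉₊ : ℝ) + 1) ≤ 9 * K := by linarith
      have h2 : (2 * (⌈9 * K⌉₊ : ℝ) + 1) ≤ 21 * K := by linarith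
      have h3 : (2 * (⌈6 * K⌉₊ : ℝ) + 1) ≤ 15 * K := by linarith
      have h4 : ((⌈3 * K⌉₊ : ℝ) + ⌈9 * K⌉₊ + ⌈6 * K⌉₊) ≤ 21 * K := by linarith
      calc (2 * (⌈3 * K⌉₊ : ℝ) + 1) * (2 * (⌈9 * K⌉₊ : ℝ) + 1) * (2 * (⌈6 * K⌉₊ : ℝ) + 1) *
            ((⌈3 * K⌉₊ : ℝ) + ⌈9 * K⌉₊ + ⌈6 * K⌉₊)
          ≤ (9 * K) * (21 * K) * (15 * K) * (21 * K) := by gcongr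
        _ = 59535 * K ^ 4 := by ring
    have hov' : (∫ y, dens x K y * ubig y) ≤ bumpConst / (Real.sqrt 2 * K ^ 3) * (59535 * K ^ 4 * (2 * D)) := by
      simp only [hubig]
      refine hov.trans ?_
      exact mul_le_mul_of_nonneg_left (mul_le_mul_of_nonneg_right hQ (by positivity)) (by positivity)
    -- constants
    have hA : 4 * (bumpConst / (Real.sqrt 2 * K ^ 3) * (59535 * K ^ 4 * (2 * D))) ≤
        400000 * bumpConst * (K * D) := by
      rw [show 4 * (bumpConst / (Real.sqrt 2 * K ^ 3) * (59535 * K ^ 4 * (2 * D))) =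
        (476280 / Real.sqrt 2) * (bumpConst * (K * D)) by field_simp; ring]
      rw [show 400000 * bumpConst * (K * D) = 400000 * (bumpConst * (K * D)) by ring]
      refine mul_le_mul_of_nonneg_right ?_ (by positivity)
      rw [div_le_iff₀ hr2]; nlinarith
    have hB : 4 * (8 * K * δ) * ((N : ℝ) / Real.sqrt 2) ≤ 400000 * bumpConst * ((N : ℝ) / K) := by
      have hδ' : δ ≤ 509 * bumpConst / K ^ 2 := by
        rw [hδ]
        have e : 2 / Real.sqrt 3 * (12 * bumpConst / K ^ 4 * ((2 * (K + 2)) * (2 * (K + 2)))) =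
            (96 / Real.sqrt 3) * ((K + 2) ^ 2 / K ^ 4) * bumpConst := by field_simp; ring
        rw [e, show 509 * bumpConst / K ^ 2 = 509 / K ^ 2 * bumpConst by ring]
        refine mul_le_mul_of_nonneg_right ?_ hb.le
        have h96 : 96 / Real.sqrt 3 ≤ 509 / 9 := by
          rw [div_le_div_iff₀ (by positivity) (by norm_num)]; nlinarith
        have hK2 : (K + 2) ^ 2 / K ^ 4 ≤ 9 / K ^ 2 := by
          rw [div_le_div_iff₀ (by positivity) (by positivity)]
          have : (K + 2) ^ 2 ≤ 9 * K ^ 2 := by nlinarith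
          nlinarith [pow_pos hK0 2, pow_pos hK0 4]
        calc 96 / Real.sqrt 3 * ((K + 2) ^ 2 / K ^ 4) ≤ (509 / 9) * (9 / K ^ 2) :=
            mul_le_mul h96 hK2 (by positivity) (by positivity)
          _ = 509 / K ^ 2 := by field_simp
      have hN0 : 0 ≤ (N : ℝ) := by positivity
      calc 4 * (8 * K * δ) * ((N : ℝ) / Real.sqrt 2)
          ≤ 4 * (8 * K * (509 * bumpConst / K ^ 2)) * ((N : ℝ) / Real.sqrt 2) := by gcongr
        _ = (16288 / Real.sqrt 2) * (bumpConst * ((N : ℝ) / K)) := by field_simp; ring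
        _ ≤ 400000 * (bumpConst * ((N : ℝ) / K)) := by
            refine mul_le_mul_of_nonneg_right ?_ (by positivity)
            rw [div_le_iff₀ hr2]; nlinarith
        _ = 400000 * bumpConst * ((N : ℝ) / K) := by ring
    calc 4 * (∫ y, dens x K y * ubig y) + 4 * (8 * K * δ) * ((N : ℝ) / Real.sqrt 2)
        ≤ 4 * (bumpConst / (Real.sqrt 2 * K ^ 3) * (59535 * K ^ 4 * (2 * D))) +
          4 * (8 * K * δ) * ((N : ℝ) / Real.sqrt 2) := by linarith [hov']
      _ ≤ 400000 * bumpConst * (K * D) + 400000 * bumpConst * ((N : ℝ) / K) := add_le_add hA hB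
      _ = 400000 * bumpConst * (K * D + (N : ℝ) / K) := by ring
  · -- small `K`: `∫ |E| ≤ ∫ v = N/√2 ≤ 192·b·N/K`
    rw [not_le] at hKbig
    have hstep : ∫ y : Fin 3 → ℝ, |(∑ i ∈ Finset.univ.filter (fun i => σ (idx i).1 ≠ 1),
        bump K (y - WithLp.ofLp (x i))) - window σ K (y 2) * ∑ i, bump K (y - WithLp.ofLp (x i))| ≤
        ∫ y, dens x K y :=
      integral_mono_of_nonneg hnonneg hvint (ae_of_all _ fun y => (hpt y).1)
    refine hstep.trans ?_
    rw [hint_v]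
    have hN0 : 0 ≤ (N : ℝ) := by positivity
    have h1 : (N : ℝ) / Real.sqrt 2 ≤ 400000 * bumpConst * ((N : ℝ) / K) := by
      -- `1/√2 ≤ 400000 b / K` since `K < 192 √2 b`
      rw [div_eq_mul_inv, div_eq_mul_inv]
      have : (Real.sqrt 2)⁻¹ ≤ 400000 * bumpConst * K⁻¹ := by
        rw [← div_eq_mul_inv, le_div_iff₀ hK0, inv_mul_le_iff₀ hr2]
        nlinarith
      nlinarith
    calc (N : ℝ) / Real.sqrt 2 ≤ 400000 * bumpConst * ((N : ℝ) / K) := h1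
      _ ≤ 400000 * bumpConst * (K * D + (N : ℝ) / K) := by
          apply mul_le_mul_of_nonneg_left _ (by positivity)
          nlinarith

end Summit.Ventures.Crystal3D.Theorems.PlateauHeight

end
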